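import Summits.QuantumFields.YangMills.Theorems.ParabolicTrajectoryLatticeGapOnTrajectoryTransferFromOSGap
import Literature.MathematicalPhysics.QuantumLattice.ReflectedCorrelationPolarisationSlack
import Literature.MathematicalPhysics.QuantumFieldTheory.SpeciesLatticeSupBounds
import HarnessLib

/-!
# Crux `LatticeGapOnTrajectory` (stmt-QuantumFields-10523), line `orbit-kantorovich-finite-size`:
# the transfer clause from a torus OS gap WITH thermal slack (A3)

Helper file (`--supports stmt-QuantumFields-10523`) for the registered stub `stub_transfer`, the
honest version of `…TransferFromOSGap` (A2). There the hypothesis `TorusOSGap r sch Δ` asks, on the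
scheme's torus of side `2L_k + 1`, for `‖corr_k(X; m)‖ ≤ V_OS(X) · e^{−Δ a_k m}` with constant EXACTLY
the OS variance and all `m ≤ L_k − 2w` — an idealisation that is false on a torus: the backward
(thermal) propagation around the time circle contributes terms of relative size `O(1)` near the
antipode (two-level transfer matrix: a factor `2`; OS-null `X`: unbounded ratio). The honest lattice
statement carries an additive slack controlled by the SUP norm of the observable:

* `TorusOSGapSlack r sch Δ ε`: eventually in `k`, for every measurable `X` with sup bound `B`
  depending only on the links at lattice times `1 … w`, and every `m` with `m + 2w ≤ L_k`,
  `‖corr_k(X; m)‖ ≤ Re corr_k(X; 0) · e^{−Δ a_k m} + ε_k B²` — literally the expression of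
  `TorusOSGap` plus `ε k * B ^ 2` (`torusOSGapSlack_of_torusOSGap`: `TorusOSGap → TorusOSGapSlack _ 0`);
* `HasPolynomialRenormalisations sch'`: `|c_s(k)|, |m_s(k)| ≤ K_s a_k^{-q_s}`;
* `transferHalf_of_torusOSGapSlack`: if the slack is `a_k`-superpolynomially small
  (`ε_k a_k^{-p} → 0` for every `p`; thermal slack is `O(e^{−c L_k})` while `a_k^{-1} = M^{n_k}`),
  then `TorusOSGapSlack r sch Δ ε` gives the transfer clause `T.HasMassGap Δ` — same rate — for
  every scheme `sch' ~ sch` with reflection-symmetric, polynomially bounded witness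
  renormalisations and every OS datum `T` with `IsYangMillsFor r sch' T`.

Proof delta versus A2 (`hasMassGap_of_torusOSGapSlack`): the diagonal lattice inequality for
`Z = X_F + c X_{G'}` now reads `‖corr(Z; m)‖ ≤ V_k(Z) e^{−Δt} + ε_k B_Z²`, `B_Z ≤ B_F + B_{G'}`, so
polarisation (`norm_osCorr_le_of_gap_slack`, `ReflectedCorrelationPolarisationSlack`) bounds
`|corr_k(X_F, X_{G'}; t/a_k)|` by `2 (V_k(F) + V_k(G')) e^{−Δt} + ε_k (B_F + B_{G'})² (e^{−Δt} + 1)`;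
the sup norms of the lattice representatives are polynomial in `a_k^{-1}`
(`SlabSum.exists_norm_rep_le_pow`, `SpeciesLatticeSupBounds`: mesh-uniform Riemann sums of the
Schwartz factors, `|O_s| ≤ C_s`, polynomial `c_s, m_s`), hence the extra term is
`≤ 4 K² (e^{−Δt}+1) · ε_k a_k^{−2q} → 0` and the limit inequality
`|𝔖_{n+m}(ΘF* ⊗ T_t G') − 𝔖_n(ΘF*) 𝔖_m(G')| ≤ 2 (V(F) + V(G')) e^{−Δt}` is unchanged; everything else
(representatives, reflection identity, off-diagonality, `M`-adic times, limits) is A2's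
(`…TransferLimits`, `…TransferFromOSGap`, `…TransferReduction`).

References: Osterwalder–Seiler 1978 §2; Glimm–Jaffe 1987 §6.1 and §19.7 (transfer matrix on a
periodic box); the item's evidence `transfer-analysis.md`.
-/

open scoped SchwartzMap Topology ComplexConjugate
open Filter Set MeasureTheory
open Literature.MathematicalPhysics.AQFT Literature.MathematicalPhysics.QuantumLattice
open Literature.MathematicalPhysics.QuantumFieldTheory

noncomputable section

namespace Summit.QuantumFields.YangMills.Cruxes.LatticeGapOnTrajectory.OrbitKantorovichFiniteSize

namespace Transfer

/-! ## §1 The hypotheses: torus OS gap with thermal slack; polynomial renormalisations -/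

variable {G : Type} [Group G] [TopologicalSpace G] [IsTopologicalGroup G] [CompactSpace G]
  [MeasurableSpace G] [BorelSpace G]

/-- **Lattice mass gap `Δ` in OS currency on the scheme's torus, WITH thermal slack `ε_k B²`.**
Eventually in `k`: for every measurable `X` on the configurations of the torus of side `2L_k + 1`
with sup bound `B` (`‖X U‖ ≤ B`), depending only on the links based at lattice times `1, …, w`,
and every `m` with `m + 2w ≤ L_k`,
`‖∫ conj X(Θ'U) · X(τ_m U) dμ_k − conj(∫X) ∫X‖ ≤ Re(∫ conj X(Θ'U) · X(U) dμ_k − conj(∫X) ∫X) · e^{−Δ a_k m} + ε_k B²`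
— literally the two sides of `TorusOSGap` (same `μ_k = wilsonMeasure r.ρ β_k`, site reflection
`Θ' = GaugeConfig.negReflect`, time translation `τ_m = torusTimeShift _ m`) plus the slack. On the
positive-time half of a torus of time extent `2L_k + 1` the transfer-matrix bound
`⟨Ψ_X, (T^m − |Ω⟩⟨Ω|) Ψ_X⟩ ≤ ‖Ψ_X − ⟨Ω,Ψ_X⟩Ω‖² e^{−aΔm}` holds only up to the backward (thermal)
propagation `tr(T^{side−m} …)`, which is NOT controlled by the OS variance but by sup norms; `ε_k`
records its size (a HYPOTHESIS of the bridge). [cite: GlimmJaffe1987, §6.1 and §19.7] [cite: OsterwalderSeiler1978, §2] -/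
def TorusOSGapSlack (r : LatticeRep G) (sch : SpeciesScheme (YMSpecies G)) (Δ : ℝ) (ε : ℕ → ℝ) :
    Prop :=
  ∃ k₀ : ℕ, ∀ k ≥ k₀, ∀ (w m : ℕ) (X : GaugeConfig 4 (sch.side k) G → ℂ) (B : ℝ), Measurable X →
    (∀ U, ‖X U‖ ≤ B) →
    DependsOn X {e : Edge 4 (sch.side k) | 1 ≤ (e.1 0).val ∧ (e.1 0).val ≤ w} →
    m + 2 * w ≤ sch.L k →
      ‖(∫ U, conj (X U.negReflect) * X (torusTimeShift (sch.side k) m U) ∂(wilsonMeasure r.ρ (sch.β k))) -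
          conj (∫ U, X U ∂(wilsonMeasure r.ρ (sch.β k))) *
            ∫ U, X U ∂(wilsonMeasure r.ρ (sch.β k))‖ ≤
        ((∫ U, conj (X U.negReflect) * X U ∂(wilsonMeasure r.ρ (sch.β k))) -
            conj (∫ U, X U ∂(wilsonMeasure r.ρ (sch.β k))) *
              ∫ U, X U ∂(wilsonMeasure r.ρ (sch.β k))).re *
          Real.exp (-Δ * sch.a k * m) + ε k * B ^ 2

/-- Sanity check: the idealised `TorusOSGap` is `TorusOSGapSlack` with zero slack (the two
predicates share their integrands literally). [folklore] -/
theorem torusOSGapSlack_of_torusOSGap {r : LatticeRep G} {sch : SpeciesScheme (YMSpecies G)} {Δ : ℝ}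
    (h : TorusOSGap r sch Δ) : TorusOSGapSlack r sch Δ 0 := by
  obtain ⟨k₀, hk₀⟩ := h
  refine ⟨k₀, fun k hk w m X B hX hB hdep hm => ?_⟩
  have h1 := hk₀ k hk w m X hX ⟨B, hB⟩ hdep hm
  simpa only [Pi.zero_apply, zero_mul, add_zero] using h1

/-- The slack may always be enlarged. [folklore] -/
theorem TorusOSGapSlack.mono {r : LatticeRep G} {sch : SpeciesScheme (YMSpecies G)} {Δ : ℝ}
    {ε ε' : ℕ → ℝ} (h : TorusOSGapSlack r sch Δ ε) (hε : ∀ k, ε k ≤ ε' k) :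
    TorusOSGapSlack r sch Δ ε' := by
  obtain ⟨k₀, hk₀⟩ := h
  refine ⟨k₀, fun k hk w m X B hX hB hdep hm => (hk₀ k hk w m X B hX hB hdep hm).trans ?_⟩
  have : ε k * B ^ 2 ≤ ε' k * B ^ 2 := mul_le_mul_of_nonneg_right (hε k) (sq_nonneg B)
  linarith

/-- **Polynomially bounded witness renormalisations**: every species `s` has `q, K` with
`|c_s(k)| ≤ K a_k^{-q}` and `|m_s(k)| ≤ K a_k^{-q}` for all `k` (multiplicative renormalisations and
counterterms of lattice perturbation theory grow at most polynomially in the cutoff). [folklore] -/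
def HasPolynomialRenormalisations {ι : Type} (sch' : SpeciesScheme ι) : Prop :=
  ∀ s, ∃ (q : ℕ) (K : ℝ), ∀ k,
    |sch'.c s k| ≤ K * ((sch'.a k)⁻¹) ^ q ∧ |sch'.m s k| ≤ K * ((sch'.a k)⁻¹) ^ q

/-- Non-vacuity: the degenerate scheme (`c = m ≡ 0`) has polynomially bounded renormalisations.
[folklore] -/
theorem hasPolynomialRenormalisations_zero (ι : Type) :
    HasPolynomialRenormalisations (SpeciesScheme.zero ι) := fun _ =>
  ⟨0, 0, fun _ => by simp [SpeciesScheme.zero]⟩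

/-! ## §2 The bridge with slack -/

/-- **The bridge with slack, one scheme.** For an `M`-adic scheme `S` (`a_k = M^{-n_k}`, `M ≥ 2`)
with reflection-symmetric, polynomially bounded renormalisations and an `a_k`-superpolynomially
small slack `ε` (`ε_k a_k^{-p} → 0` for all `p`), `TorusOSGapSlack r S Δ ε` implies `T.HasMassGap Δ`
for every OS datum `T` with `IsYangMillsFor r S T`: A2's density reduction, representatives and
limits; polarisation WITH slack; the slack term `ε_k (B_F + B_{G'})² (e^{−Δt}+1) ≤ 4K²(e^{−Δt}+1) ε_k a_k^{−2q}`
tends to zero. [cite: GlimmJaffe1987, §6.1 and §19.7] [cite: OsterwalderSeiler1978, §2] -/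
theorem hasMassGap_of_torusOSGapSlack (r : LatticeRep G) {M : ℕ} {S : SpeciesScheme (YMSpecies G)}
    {n : ℕ → ℕ} {Δ : ℝ} {ε : ℕ → ℝ} (hM : 2 ≤ M) (hshape : ∀ k, S.a k = ((M : ℝ) ^ n k)⁻¹)
    (hε : ∀ p : ℕ, Tendsto (fun k => ε k * ((S.a k)⁻¹) ^ p) atTop (𝓝 0))
    (hgap : TorusOSGapSlack r S Δ ε) (hsym : S.IsReflectionSymmetric)
    (hpoly : HasPolynomialRenormalisations S) {T : OSData (YMSpecies G) 4}
    (hT : IsYangMillsFor r S T) : T.HasMassGap Δ := by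
  -- adapted from `…TransferFromOSGap` (`hasMassGap_of_torusOSGap`), with the slack carried through
  have hV : ∀ (p : ℕ) (l₁ : Fin (p + p) → YMSpecies G) (l₂ l₃ : Fin p → YMSpecies G),
      Continuous fun F : 𝓢((Fin p → EuclideanSpace ℝ (Fin 4)), ℂ) =>
        (T.schwinger (p + p) l₁ ((osAdjoint F).appendTensor F) -
          T.schwinger p l₂ (osAdjoint F) * T.schwinger p l₃ F).re := fun p l₁ l₂ l₃ =>
    Complex.continuous_re.comp ((((T.schwinger (p + p) l₁).continuous.comp
      (continuous_appendTensor.comp (continuous_osAdjoint.prodMk continuous_id))).sub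
      (((T.schwinger p l₂).continuous.comp continuous_osAdjoint).mul (T.schwinger p l₃).continuous)))
  obtain ⟨k₀, hk₀⟩ := hgap
  refine hasMassGap_of_dense_clustering T Δ
    (fun p => (Submodule.span ℂ (slabOrderedProducts 4 p) : Set _))
    (fun p F hF => hF.mem_closure_span_slabOrderedProducts) _ (dense_MAdic hM)
    (fun p q σ σ' F G' => 2 * ((T.schwinger (p + p) (Fin.append (σ ∘ Fin.rev)
        (fun i => (σ i).timeReflect)) ((osAdjoint F).appendTensor F) -
        T.schwinger p (σ ∘ Fin.rev) (osAdjoint F) * T.schwinger p (fun i => (σ i).timeReflect) F).re +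
      (T.schwinger (q + q) (Fin.append ((fun j => (σ' j).timeReflect) ∘ Fin.rev) σ')
        ((osAdjoint G').appendTensor G') -
        T.schwinger q ((fun j => (σ' j).timeReflect) ∘ Fin.rev) (osAdjoint G') *
          T.schwinger q σ' G').re))
    (fun p q σ σ' => continuous_const.mul (((hV p _ _ _).comp continuous_fst).add
      ((hV q _ _ _).comp continuous_snd)))
    (fun p q σ σ' F G' hF hG' t ht ht0 => ?_)
  obtain ⟨D, rfl⟩ := SlabSum.exists_of_mem_span hF
  obtain ⟨D', rfl⟩ := SlabSum.exists_of_mem_span hG'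
  obtain ⟨i₀, j, rfl⟩ := ht
  have hM0 : (0 : ℝ) < M := by exact_mod_cast lt_of_lt_of_le (by norm_num) hM
  have hMi : (0 : ℝ) < (M : ℝ) ^ i₀ := pow_pos hM0 i₀
  have hj : (0 : ℤ) ≤ j := by
    by_contra hneg
    push Not at hneg
    have : (j : ℝ) / (M : ℝ) ^ i₀ < 0 := div_neg_of_neg_of_pos (by exact_mod_cast hneg) hMi
    linarith
  obtain ⟨jn, rfl⟩ := Int.eq_ofNat_of_zero_le hj
  set t : ℝ := ((jn : ℤ) : ℝ) / (M : ℝ) ^ i₀ with htdef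
  -- the lattice time shifts realising `t`
  have hs : ∀ᶠ k in atTop, S.a k * ((jn * M ^ (n k - i₀) : ℕ) : ℝ) = t := by
    filter_upwards [(tendsto_n_of_shape S hM hshape).eventually_ge_atTop i₀] with k hk
    rw [hshape k, htdef]
    push_cast
    rw [pow_sub₀ _ hM0.ne' hk]
    field_simp
  -- limits
  have hcorr := tendsto_osCorr_rep r hT hsym D D' (fun i => (σ i).timeReflect) σ' ht0 hs
  have hvarF := tendsto_osVar_rep r hT hsym D (fun i => (σ i).timeReflect)
  have hvarG := tendsto_osVar_rep r hT hsym D' σ'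
  simp only [LocalGaugeObservable.timeReflect_timeReflect] at hcorr hvarF
  -- polynomial sup bounds of the representatives; the slack term tends to zero
  obtain ⟨qF, KF, hKF0, hKF⟩ :=
    D.exists_norm_rep_le_pow S (fun i => (σ i).timeReflect) fun i => hpoly _
  obtain ⟨qG, KG, hKG0, hKG⟩ := D'.exists_norm_rep_le_pow S σ' fun j => hpoly _
  have hslack : Tendsto (fun k => ε k * (S.a k)⁻¹ ^ (2 * (qF + qG)) *
      (4 * (KF + KG) ^ 2 * (Real.exp (-Δ * t) + 1))) atTop (𝓝 0) := by
    simpa using (hε (2 * (qF + qG))).mul_const (4 * (KF + KG) ^ 2 * (Real.exp (-Δ * t) + 1))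
  refine le_of_tendsto_of_tendsto ((continuous_norm.tendsto _).comp hcorr)
    (by simpa only [add_zero] using
      ((((hvarF.add hvarG).const_mul 2).mul_const (Real.exp (-Δ * t))).add hslack)) ?_
  -- the eventual lattice bound: polarised `TorusOSGapSlack`
  obtain ⟨loF, hloF, hloF'⟩ := exists_pos_le_lo D
  obtain ⟨loG, hloG, hloG'⟩ := exists_pos_le_lo D'
  obtain ⟨hiF, hhiF, hhiF'⟩ := exists_hi_le D
  obtain ⟨hiG, hhiG, hhiG'⟩ := exists_hi_le D'
  set R : ℕ := (Finset.univ.sup fun i => timeRadius (σ i).timeReflect) ⊔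
    (Finset.univ.sup fun j => timeRadius (σ' j)) with hR
  have hRF : ∀ i, timeRadius (σ i).timeReflect ≤ R := fun i =>
    (Finset.le_sup (f := fun i => timeRadius (σ i).timeReflect) (Finset.mem_univ i)).trans le_sup_left
  have hRG : ∀ j, timeRadius (σ' j) ≤ R := fun j =>
    (Finset.le_sup (f := fun j => timeRadius (σ' j)) (Finset.mem_univ j)).trans le_sup_right
  set lo₀ := min loF loG with hlo₀
  set hi₀ := max hiF hiG with hhi₀
  have hlo₀pos : 0 < lo₀ := lt_min hloF hloG
  have e3 : ∀ᶠ k in atTop, S.a k ≤ lo₀ / (R + 1) :=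
    S.tendsto_a.eventually_le_const (by positivity)
  have e4 : ∀ᶠ k in atTop, S.a k ≤ 1 := S.tendsto_a.eventually_le_const one_pos
  have e5 : ∀ᶠ k in atTop, t + 2 * hi₀ + 2 * (R + 2) ≤ S.a k * S.L k :=
    S.tendsto_L.eventually_ge_atTop _
  filter_upwards [eventually_ge_atTop k₀, hs, e3, e4, e5] with k hk1 hk2 hk3 hk4 hk5
  have ha := S.a_pos k
  haveI := isProbabilityMeasure_wilsonMeasure (d := 4) (L := S.side k) r.ρ r.continuous (S.β k)
  -- the window `w` and the arithmetic
  set w : ℕ := ⌈hi₀ / S.a k⌉₊ + R with hw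
  have hw1 : hi₀ + S.a k * R ≤ S.a k * w := by
    have h1 : hi₀ / S.a k ≤ ⌈hi₀ / S.a k⌉₊ := Nat.le_ceil _
    rw [div_le_iff₀ ha] at h1
    simp only [hw, Nat.cast_add]
    nlinarith
  have hw2 : (w : ℝ) ≤ hi₀ / S.a k + 1 + R := by
    have h1 := Nat.ceil_lt_add_one (div_nonneg ((le_max_left _ _).trans' hhiF) ha.le : 0 ≤ hi₀ / S.a k)
    simp only [hw, Nat.cast_add]
    linarith
  have hsw : jn * M ^ (n k - i₀) + 2 * w ≤ S.L k := by
    have h1 : ((jn * M ^ (n k - i₀) : ℕ) : ℝ) = t / S.a k := by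
      rw [eq_div_iff ha.ne', mul_comm, hk2]
    have h2 : t / S.a k + 2 * (hi₀ / S.a k + 1 + R) ≤ S.L k := by
      refine le_of_mul_le_mul_left ?_ ha
      have h4 : S.a k * (t / S.a k + 2 * (hi₀ / S.a k + 1 + R)) =
          t + 2 * hi₀ + 2 * (S.a k * (1 + R)) := by
        field_simp
        ring
      rw [h4]
      nlinarith [mul_le_mul_of_nonneg_right hk4 (by positivity : (0 : ℝ) ≤ 1 + R)]
    have h3 : ((jn * M ^ (n k - i₀) : ℕ) : ℝ) + 2 * (w : ℝ) ≤ S.L k := by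
      rw [h1]; linarith
    exact_mod_cast h3
  have hwside : w < S.side k := by
    simp only [SpeciesScheme.side]; omega
  -- the common sup bound of the two representatives at this `k`
  obtain ⟨Bk, hBk⟩ : ∃ Bk : ℝ, Bk = (KF + KG) * (S.a k)⁻¹ ^ (qF + qG) := ⟨_, rfl⟩
  have hA1 : 1 ≤ (S.a k)⁻¹ := (one_le_inv₀ ha).2 hk4
  have hBF : ∀ U, ‖D.rep S (fun i => (σ i).timeReflect) k U‖ ≤ Bk := fun U => by
    rw [hBk]
    exact (hKF k hk4 U).trans (mul_le_mul (le_add_of_nonneg_right hKG0)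
      (pow_le_pow_right₀ hA1 (Nat.le_add_right _ _)) (by positivity) (by positivity))
  have hBG : ∀ U, ‖D'.rep S σ' k U‖ ≤ Bk := fun U => by
    rw [hBk]
    exact (hKG k hk4 U).trans (mul_le_mul (le_add_of_nonneg_left hKF0)
      (pow_le_pow_right₀ hA1 (Nat.le_add_left _ _)) (by positivity) (by positivity))
  have hlat : ∀ (m' : ℕ) (Z : GaugeConfig 4 (S.side k) G → ℂ) (B : ℝ), Measurable Z →
      (∀ U, ‖Z U‖ ≤ B) →
      DependsOn Z {e : Edge 4 (S.side k) | 1 ≤ (e.1 0).val ∧ (e.1 0).val ≤ w} → m' + 2 * w ≤ S.L k →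
      ‖osCorr (wilsonMeasure r.ρ (S.β k)) GaugeConfig.negReflect (torusTimeShift (S.side k) m') Z Z‖ ≤
        osVar (wilsonMeasure r.ρ (S.β k)) GaugeConfig.negReflect Z * Real.exp (-Δ * S.a k * m') +
          ε k * B ^ 2 :=
    fun m' Z B hZ hbZ hdZ hm' => hk₀ k hk1 w m' Z B hZ hbZ hdZ hm'
  refine (norm_osCorr_le_of_gap_slack (μ := wilsonMeasure r.ρ (S.β k)) (E := Real.exp (-Δ * t))
    (δ := ε k)
    (Good := fun Z => Measurable Z ∧
      DependsOn Z {e : Edge 4 (S.side k) | 1 ≤ (e.1 0).val ∧ (e.1 0).val ≤ w})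
    WilsonSiteRP.measurable_negReflect (torusTimeShift _ _).measurable (fun Z hZ => hZ.1)
    (fun X Y c hX hY => ⟨hX.1.add (hY.1.const_smul c), ?_⟩) (Real.exp_pos _).le
    (fun Z B hZ hB => ?_) (fun Z B hZ hB => ?_)
    ⟨D.measurable_rep S (fun i => (σ i).timeReflect) k,
      D.dependsOn_rep S _ k hRF (fun i j' => ?_) (fun i j' => ?_) hwside⟩
    ⟨D'.measurable_rep S σ' k, D'.dependsOn_rep S _ k hRG (fun i j' => ?_) (fun i j' => ?_) hwside⟩
    hBF hBG).trans (le_of_eq ?_)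
  · intro U V hUV
    simp only [Pi.add_apply, Pi.smul_apply]
    rw [hX.2 hUV, hY.2 hUV]
  · have h := hlat _ Z B hZ.1 hB hZ.2 hsw
    rwa [mul_assoc, hk2] at h
  · have h := hlat 0 Z B hZ.1 hB hZ.2 (by omega)
    simp only [Nat.cast_zero, mul_zero, Real.exp_zero, mul_one] at h
    have h0 := (norm_nonneg _).trans h
    linarith
  · have hk3' : S.a k * (R + 1) ≤ lo₀ := (le_div_iff₀ (by positivity)).1 hk3
    exact hk3'.trans ((min_le_left _ _).trans (hloF' i j'))
  · linarith [hhiF' i j', le_max_left hiF hiG]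
  · have hk3' : S.a k * (R + 1) ≤ lo₀ := (le_div_iff₀ (by positivity)).1 hk3
    exact hk3'.trans ((min_le_right _ _).trans (hloG' i j'))
  · linarith [hhiG' i j', le_max_right hiF hiG]
  · rw [hBk]
    ring

/-- **The transfer clause of the crux from a torus OS gap with thermal slack** (the honest repair
of `stub_transfer`): for the `M`-adic scheme `sch` of the crux (`a_k = M^{-n_k}`, `M ≥ 2`) and an
`a_k`-superpolynomially small slack `ε`, `TorusOSGapSlack r sch Δ ε` gives `T.HasMassGap Δ` — same
rate — for EVERY scheme `sch'` with the same spacings, couplings and volumes whose witness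
renormalisations are time-reflection symmetric and polynomially bounded, and every OS datum `T`
with `IsYangMillsFor r sch' T`. [cite: GlimmJaffe1987, §6.1 and §19.7] [cite: OsterwalderSeiler1978, §2] -/
theorem transferHalf_of_torusOSGapSlack
    (r : LatticeRep G) (M : ℕ) (sch : SpeciesScheme (YMSpecies G)) (n : ℕ → ℕ) (Δ : ℝ) (ε : ℕ → ℝ)
    (hM : 2 ≤ M) (hshape : ∀ k, sch.a k = ((M : ℝ) ^ n k)⁻¹)
    (hε : ∀ p : ℕ, Tendsto (fun k => ε k * ((sch.a k)⁻¹) ^ p) atTop (𝓝 0))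
    (hgap : TorusOSGapSlack r sch Δ ε) :
    ∀ sch' : SpeciesScheme (YMSpecies G), sch'.a = sch.a → sch'.β = sch.β → sch'.L = sch.L →
      sch'.IsReflectionSymmetric → HasPolynomialRenormalisations sch' →
        ∀ T : OSData (YMSpecies G) 4, IsYangMillsFor r sch' T → T.HasMassGap Δ := by
  intro sch' ha hβ hL hsym hpoly T hT
  obtain ⟨a', ha', hta', β', L', htL', c', m'⟩ := sch'
  have ha1 : a' = sch.a := ha
  have hβ1 : β' = sch.β := hβ
  have hL1 : L' = sch.L := hL
  subst ha1 hβ1 hL1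
  exact hasMassGap_of_torusOSGapSlack r hM (S := ⟨sch.a, ha', hta', sch.β, sch.L, htL', c', m'⟩)
    hshape hε hgap hsym hpoly hT

end Transfer

end Summit.QuantumFields.YangMills.Cruxes.LatticeGapOnTrajectory.OrbitKantorovichFiniteSize

end
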